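import Summits.ABC.IUTFork.Cor312LicenceShallowReal
import Summits.ABC.IUTFork.Thm311RealIsmDHOrbitSpan
import HarnessLib

/-!
# [IUTchIII] Cor. 3.12 — the (xi-f) licence at the sharp real settings from LOG-SHELL LEVELS at ANY place
# (wild ramification and `p = 2` included): `t_Θ` primitive in a level `c·log_p(𝒪_v^×)` whose top dominates `t_q`

PROOF-ONLY record file (D-0012; 0 definitions, 0 `Prop` facts) of the abc-iut cell (WAVE-5 prover seat abc-iut-w5-d236,
gen 8; row «LICENCE-SHALLOW-RAMIFIED-KERNEL» part (D)). TAKES NO SIDE on [IUTchIII] Cor. 3.12 or on any author.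
`Cor312LicenceShallowRealTame` supplies the one-factor movers of `Cor312LicenceShallowReal` at TAME places, where the
lattice `Λ_v := log_p(𝒪_v^×)` is the ball `𝔪_v`. The mover itself needs no evaluation of `Λ_v`: abc-iut-w5-d180's
`exists_mem_ismDH_apply_eq_of_primitive` (Weil *BNT* II §2 Th. 1 through the (Ind2) dictionary) says that Dupuy–Hilado's
(Ind2) group `Real.ismDH` is TRANSITIVE on the primitive vectors of every homothetic copy `c·Λ_v` — at EVERY finite place
with the analytic logarithm, any residue characteristic, any ramification. Hence:

* `exists_mover_of_level` — if `t_Θ ∈ c·Λ_v ∖ p·c·Λ_v` and some `y ∈ c·Λ_v ∖ p·c·Λ_v` has `‖t_q‖ ≤ ‖y‖`, then some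
  `g ∈ Real.ismDH logv (inr v)` has `‖t_q‖ ≤ ‖g t_Θ‖`;
* **`licence_settingDHVolSharp_of_levels`** / **`licence_settingPrVolSharp_of_levels`** /
  **`exists_qPinned_and_hull_settingPrVolSharp_of_levels`** — the (xi-f) licence at abc-iut-c312-3's / c312-7's sharp
  real settings, and branch C's «∃ ρ qK, QPinned ∧ PilotKummerCompatHull» (any columns, integral `t_q`), whenever at every
  `(p, j, x)` EITHER `‖t_{q,x}‖ ≤ ‖t_{Θ,j,x}‖` OR `t_{Θ,j,x}` is primitive in a level `c·Λ_x` containing a primitive vector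
  of norm `≥ ‖t_{q,x}‖` — the ramification-free form of the tame window (there `Λ_x = 𝔪_x`, levels = `p^k·𝔪_x`).

HONEST SCOPE as in the companions: OUR typed sharp containers (Θ-regions constant in `m`) and Dupuy–Hilado's typed (Ind2)
= lattice isomorphisms of `I_v = (p^*)⁻¹·Λ_v`; STRONGER-THAN-PRINT hull reading; nothing about the printed GLOBAL inequality;
nothing asserts or refutes [IUTchIII] Cor. 3.12. [cite: DupuyHilado2025, §3.9, §4.9] [cite: WeilBNT1967, Ch. II §2, Th. 1–2]
[claim: Mochizuki2012, status: disputed] for every IUT sentence quoted. typed ≠ proved; instantiated ≠ endorsed.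
-/

noncomputable section

open Set Metric Function NumberField IsDedekindDomain
open scoped Pointwise

namespace Summit.ABC.IUTFork.Thm311.Real

open Cor312 Cor312.Setting Cor312Vol Literature.IUT.LogThetaLattice Literature.IUT.LogVolume
open Literature.NumberTheory.NumberFields

/-! ## 1. One factor, any place: a mover from a common level of `log_p(𝒪_v^×)` -/

section OneFactor

variable {F : Type} [Field F] [NumberField F] {p : ℕ} [hp : Fact p.Prime]
variable {logv : PadicLogs F} (hlog : LogvAnalyticAt p logv)
variable (v : HeightOneSpectrum (𝓞 F)) (hv : ((p : ℕ) : 𝓞 F) ∈ v.asIdeal)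

include hlog in
/-- **A MOVER FROM A COMMON LEVEL, at any finite place** (any `p`, any ramification): if `t` and `y` are both primitive vectors of
the same homothetic copy `c·log_p(𝒪_v^×)` (in it, not in `p·c·log_p(𝒪_v^×)`) and `‖t_q‖ ≤ ‖y‖`, some element of Dupuy–Hilado's
(Ind2) group carries `t` to `y`, so `‖t_q‖ ≤ ‖g t‖`. [cite: WeilBNT1967, Ch. II §2, Th. 1] [cite: DupuyHilado2025, §4.9] -/
theorem exists_mover_of_level {c : ℚ_[p]} {t y tq : RescaledCompletion F p v hv}
    (ht : t ∈ c • (logUnits (RescaledCompletion F p v hv) : Set (RescaledCompletion F p v hv)))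
    (htp : t ∉ ((p : ℚ_[p]) * c) • (logUnits (RescaledCompletion F p v hv) : Set (RescaledCompletion F p v hv)))
    (hy : y ∈ c • (logUnits (RescaledCompletion F p v hv) : Set (RescaledCompletion F p v hv)))
    (hyp : y ∉ ((p : ℚ_[p]) * c) • (logUnits (RescaledCompletion F p v hv) : Set (RescaledCompletion F p v hv)))
    (htq : ‖tq‖ ≤ ‖y‖) :
    ∃ g ∈ ismDH logv (.inr v), ‖tq‖ ≤ ‖toR p v hv (g (ofR p v hv t))‖ := by
  obtain ⟨g, hg, hgt⟩ := exists_mem_ismDH_apply_eq_of_primitive hlog v hv ht htp hy hyp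
  exact ⟨g, hg, by rw [hgt]; exact htq⟩

end OneFactor

/-! ## 2. The sharp real settings: the licence from levels -/

section Setting

variable {F : Type} [Field F] [NumberField F] (X : PilotData F) {logv : PadicLogs F} (hlog : LogvAnalytic logv)
  (M : Type) [Field M] [NumberField M]
  (archPk : ∀ (j : (thetaIndex X).Label) (vQ : (thetaIndex X).VQ), Set ((logShellsDH X logv).Packet j vQ))
  (archSub : ∀ (j : (thetaIndex X).Label) (v : (thetaIndex X).V),
    Set ((logShellsDH X logv).Packet j ((thetaIndex X).over v)))
  (Ψ : ℤ → ∀ v : (thetaIndex X).V, v ∈ (thetaIndex X).Vbad → Set ((logShellsDH X logv).StarPacket v))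
  (act : ℤ → ∀ v : (thetaIndex X).V, v ∈ (thetaIndex X).Vbad →
    (logShellsDH X logv).StarPacket v → Module.End ℚ ((logShellsDH X logv).StarPacket v))
  (Mmod : ℤ → ∀ j : (thetaIndex X).LabelStar, Set ((logShellsDH X logv).GlobalPacket j.1))
  (region : ℤ → ∀ j : (thetaIndex X).LabelStar, FinDivisor M → ∀ vQ : (thetaIndex X).VQ,
    Set ((logShellsDH X logv).Packet j.1 vQ))
  (n : ℤ) {HT : Type} {LogLink : HT → HT → Type} {IsFull : ∀ {s t : HT}, LogLink s t → Prop}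
  (lat : LGPGaussianLogThetaLattice LogLink IsFull)
  {Frd : Type} {IsoF : Frd → Frd → Type} {Ob : Frd → Type} {realify : Frd → Frd} {Strip : Type}
  {IsoS : Strip → Strip → Type} {Mv : ∀ v : (thetaIndex X).V, v ∈ (thetaIndex X).Vbad → Type}
  [∀ v h, Monoid (Mv v h)]
  (sig : GlobalLGPFrobenioidSignature (thetaIndex X).lstar (thetaIndex X).V (· ∈ (thetaIndex X).Vbad)
    Frd IsoF Ob realify Strip IsoS Mv)
  (split : SplittingMonoids Mv) {ObΔ : Type} {N : ∀ v : (thetaIndex X).V, v ∈ (thetaIndex X).Vbad → Type}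
  [∀ v h, Monoid (N v h)] (qData : QPilotData ObΔ N)
  (tq : ∀ (pp : Nat.Primes) (x : (thetaIndex X).Fibre (.inr pp)), haveI : Fact (pp : ℕ).Prime := ⟨pp.2⟩; kOf X pp.1 x)
  (t : ∀ (pp : Nat.Primes) (_ : Fin X.lstar) (x : (thetaIndex X).Fibre (.inr pp)),
    haveI : Fact (pp : ℕ).Prime := ⟨pp.2⟩; kOf X pp.1 x)
  (htq0 : ∀ pp x, tq pp x ≠ 0)
  (htq1 : ∀ (pp : Nat.Primes) (x : (thetaIndex X).Fibre (.inr pp)),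
    haveI : Fact (pp : ℕ).Prime := ⟨pp.2⟩; placeOf X pp.1 x ∉ X.S → ‖tq pp x‖ = 1)
  (col : ℤ → Column (logShellsDH X logv))

/-- **The mover hypothesis at a fibre point from the LEVEL ALTERNATIVE** (any place): at `(p, j, x)`, EITHER `‖t_{q,x}‖ ≤ ‖t_{Θ,j,x}‖`
OR `t_{Θ,j,x}` is primitive in a level `c·log_p(𝒪_x^×)` containing a primitive `y` with `‖t_{q,x}‖ ≤ ‖y‖` — then some
`g ∈ Real.ismDH logv x` has `‖t_{q,x}‖ ≤ ‖g(t_{Θ,j,x})‖`. [cite: WeilBNT1967, Ch. II §2, Th. 1] [cite: DupuyHilado2025, §4.9] -/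
theorem exists_mover_of_level_alt (pp : Nat.Primes) (j : (thetaIndex X).Label) (x : (thetaIndex X).Fibre (.inr pp))
    (h : haveI : Fact (pp : ℕ).Prime := ⟨pp.2⟩
      ‖tq pp x‖ ≤ ‖labelIdele X t pp j x‖ ∨
        ∃ (c : ℚ_[pp]) (y : kOf X pp.1 x),
          labelIdele X t pp j x ∈ c • (logUnits (kOf X pp.1 x) : Set (kOf X pp.1 x)) ∧
          labelIdele X t pp j x ∉ ((pp : ℚ_[pp]) * c) • (logUnits (kOf X pp.1 x) : Set (kOf X pp.1 x)) ∧
          y ∈ c • (logUnits (kOf X pp.1 x) : Set (kOf X pp.1 x)) ∧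
          y ∉ ((pp : ℚ_[pp]) * c) • (logUnits (kOf X pp.1 x) : Set (kOf X pp.1 x)) ∧
          ‖tq pp x‖ ≤ ‖y‖) :
    haveI : Fact (pp : ℕ).Prime := ⟨pp.2⟩
    ∃ g ∈ ismDH logv x.1,
      ‖tq pp x‖ ≤ ‖(presAt X hlog pp).φ x (g (((presAt X hlog pp).φ x).symm (labelIdele X t pp j x)))‖ := by
  haveI : Fact (pp : ℕ).Prime := ⟨pp.2⟩
  rcases h with h | ⟨c, y, h1, h2, h3, h4, h5⟩
  · exact exists_mover_of_norm_le X hlog tq t pp j x h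
  · obtain ⟨x1, hx⟩ := x
    rcases x1 with w | v
    · exact absurd hx (by simp [thetaIndex])
    · obtain ⟨g, hg, hgn⟩ := exists_mover_of_level (hlog pp) v (natCast_mem_placeOf X pp.1 ⟨.inr v, hx⟩) h1 h2 h3 h4 h5
      exact ⟨g, hg, hgn⟩

/-- **THE (xi-f) LICENCE AT `settingDHVolSharp` FROM LEVELS (any places, any ramification, `p = 2` allowed)**: if at every prime
`p`, label `j = i+1` and place `x | p` either `‖t_{q,x}‖ ≤ ‖t_{Θ,j,x}‖` or `t_{Θ,j,x}` is primitive in a level `c·log_p(𝒪_x^×)` whose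
primitive vectors reach norm `≥ ‖t_{q,x}‖`, then `Thm311ToCor312.Licence` holds. [cite: DupuyHilado2025, §3.9, §4.9]
[cite: WeilBNT1967, Ch. II §2, Th. 1] [claim: Mochizuki2012, status: disputed] -/
theorem licence_settingDHVolSharp_of_levels
    (h : ∀ (pp : Nat.Primes) (i : Fin (thetaIndex X).lstar) (x : (thetaIndex X).Fibre (.inr pp)),
      haveI : Fact (pp : ℕ).Prime := ⟨pp.2⟩
      ‖tq pp x‖ ≤ ‖t pp i x‖ ∨
        ∃ (c : ℚ_[pp]) (y : kOf X pp.1 x),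
          t pp i x ∈ c • (logUnits (kOf X pp.1 x) : Set (kOf X pp.1 x)) ∧
          t pp i x ∉ ((pp : ℚ_[pp]) * c) • (logUnits (kOf X pp.1 x) : Set (kOf X pp.1 x)) ∧
          y ∈ c • (logUnits (kOf X pp.1 x) : Set (kOf X pp.1 x)) ∧
          y ∉ ((pp : ℚ_[pp]) * c) • (logUnits (kOf X pp.1 x) : Set (kOf X pp.1 x)) ∧
          ‖tq pp x‖ ≤ ‖y‖) :
    Thm311ToCor312.Licence (settingDHVolSharp X hlog M archPk archSub Ψ act Mmod region n lat sig split qData tq t htq0 htq1) := by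
  refine licence_settingDHVolSharp_of_movers X hlog M archPk archSub Ψ act Mmod region n lat sig split qData tq t htq0 htq1
    fun pp i x => ?_
  have hm := exists_mover_of_level_alt X hlog tq t pp (labelSucc i) x (by rw [labelIdele_labelSucc]; exact h pp i x)
  rw [labelIdele_labelSucc] at hm
  exact hm

/-- **The same at the print-normalised sharp setting `settingPrVolSharp`.** [claim: Mochizuki2012, status: disputed] -/
theorem licence_settingPrVolSharp_of_levels
    (h : ∀ (pp : Nat.Primes) (i : Fin (thetaIndex X).lstar) (x : (thetaIndex X).Fibre (.inr pp)),
      haveI : Fact (pp : ℕ).Prime := ⟨pp.2⟩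
      ‖tq pp x‖ ≤ ‖t pp i x‖ ∨
        ∃ (c : ℚ_[pp]) (y : kOf X pp.1 x),
          t pp i x ∈ c • (logUnits (kOf X pp.1 x) : Set (kOf X pp.1 x)) ∧
          t pp i x ∉ ((pp : ℚ_[pp]) * c) • (logUnits (kOf X pp.1 x) : Set (kOf X pp.1 x)) ∧
          y ∈ c • (logUnits (kOf X pp.1 x) : Set (kOf X pp.1 x)) ∧
          y ∉ ((pp : ℚ_[pp]) * c) • (logUnits (kOf X pp.1 x) : Set (kOf X pp.1 x)) ∧
          ‖tq pp x‖ ≤ ‖y‖) :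
    Thm311ToCor312.Licence (settingPrVolSharp X hlog M archPk archSub Ψ act Mmod region n lat sig split qData tq t htq0 htq1) := by
  rw [licence_settingPrVolSharp_iff_settingDHVolSharp]
  exact licence_settingDHVolSharp_of_levels X hlog M archPk archSub Ψ act Mmod region n lat sig split qData tq t htq0 htq1 h

/-- **BRANCH C's ANTECEDENT at `settingPrVolSharp` FROM LEVELS** (any columns; integral `t_q` for the label `0`).
[cite: DupuyHilado2025, §3.9, §4.9] [cite: WeilBNT1967, Ch. II §2, Th. 1] [claim: Mochizuki2012, status: disputed] -/
theorem exists_qPinned_and_hull_settingPrVolSharp_of_levels (htqle : ∀ pp x, ‖tq pp x‖ ≤ 1)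
    (h : ∀ (pp : Nat.Primes) (i : Fin (thetaIndex X).lstar) (x : (thetaIndex X).Fibre (.inr pp)),
      haveI : Fact (pp : ℕ).Prime := ⟨pp.2⟩
      ‖tq pp x‖ ≤ ‖t pp i x‖ ∨
        ∃ (c : ℚ_[pp]) (y : kOf X pp.1 x),
          t pp i x ∈ c • (logUnits (kOf X pp.1 x) : Set (kOf X pp.1 x)) ∧
          t pp i x ∉ ((pp : ℚ_[pp]) * c) • (logUnits (kOf X pp.1 x) : Set (kOf X pp.1 x)) ∧
          y ∈ c • (logUnits (kOf X pp.1 x) : Set (kOf X pp.1 x)) ∧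
          y ∉ ((pp : ℚ_[pp]) * c) • (logUnits (kOf X pp.1 x) : Set (kOf X pp.1 x)) ∧
          ‖tq pp x‖ ≤ ‖y‖) :
    ∃ (ρ : (∀ v : (thetaIndex X).V, v ∈ (thetaIndex X).Vbad → Set ((logShellsDH X logv).StarPacket v)) →
          ∀ (j : (thetaIndex X).Label) (vQ : (thetaIndex X).VQ), Set ((logShellsDH X logv).Packet j vQ))
        (qK : ∀ v : (thetaIndex X).V, v ∈ (thetaIndex X).Vbad → Set ((logShellsDH X logv).StarPacket v)),
        QPinned ({ toSituation := situationPrVol X hlog M archPk archSub Ψ act Mmod region, col := col } :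
            LatticeSituation (thetaIndex X))
          (settingPrVolSharp X hlog M archPk archSub Ψ act Mmod region n lat sig split qData tq t htq0 htq1) ρ qK ∧
        PilotKummerCompatHull ({ toSituation := situationPrVol X hlog M archPk archSub Ψ act Mmod region, col := col } :
            LatticeSituation (thetaIndex X))
          (settingPrVolSharp X hlog M archPk archSub Ψ act Mmod region n lat sig split qData tq t htq0 htq1) ρ qK := by
  refine exists_qPinned_and_hull_settingPrVolSharp_of_movers X hlog M archPk archSub Ψ act Mmod region n lat sig split qData tq t
    htq0 htq1 col fun pp j x => exists_mover_of_level_alt X hlog tq t pp j x ?_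
  haveI : Fact (pp : ℕ).Prime := ⟨pp.2⟩
  by_cases hj : 0 < (j : ℕ)
  · have hj' : j = labelSucc ⟨(j : ℕ) - 1, by have := j.2; simp only [thetaIndex] at this ⊢; omega⟩ := by
      ext; simp only [labelSucc, Fin.val_succ]; omega
    rw [hj', labelIdele_labelSucc]
    exact h pp _ x
  · left
    unfold labelIdele
    rw [dif_neg hj, norm_one]
    exact htqle pp x

end Setting

end Summit.ABC.IUTFork.Thm311.Real

end
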